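import Summits.QuantumAdvantage.QuantumAdvantage.Theses.SosSandwich
import Summits.QuantumAdvantage.QuantumAdvantage.Theorems.SosSandwichPseudoBoundedAAStubOneQuery

/-!
# Crux `PseudoBoundedAA` (stmt-QuantumAdvantage-15237, route SosSandwich, rank 2) — birth skeleton

`Lines/birth.lean` (planner-skel-stmt-QuantumAdvantage-15237-0, skeleton-register / BC3, 2026-08-17).

THE CRUX. PB-AA, the pseudo-bounded Aaronson–Ambainis statement: there are `c : ℕ`, `C > 0` such that
for all `N`, `T ≥ 1`, every real polynomial `p` on `{0,1}^N` that is PSEUDO-BOUNDED OF ORDER `T`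
(`p` and `1 - p` are sums of squares of polynomials of total degree `≤ T` as functions on the cube) and
every `0 < ε ≤ Var[p]` there is a variable `i` with `Inf_i[p] ≥ C (ε/T)^c`
(`Inf_i[p] = E_x (p(x) - p(x ⊕ e_i))²`, cube averages written inline exactly as in the route file).

THE LINE — REDUCE TO THE TWO FLAT BASE CLASSES (the route's own TWO-LAYER PLAN
"PseudoBoundedAA ⇐ HomogeneousPBAA → LevelDescent → PseudoBoundedAA", with LevelDescent now TYPED).
Influence lower bounds are available, with the sharp exponent `Var²` and NO loss in `T`, on two
sub-classes of the SOS sandwich class `K_T` where the Gram matrix is flat enough for a Cauchy–Schwarz /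
decoupling argument:
* ORDER ONE, `K_1` (sums of squares of affine functions): `4·Var[p]² ≤ 9·maxᵢ Infᵢ[p]` — the route's
  support item `OneQueryFrameAA` (stmt-QuantumAdvantage-15240, provable now: flatness at degree 1 ⟹
  orthogonal frame ⟹ Bessel), taken here BY NAME (`stub_oneQuery`);
* TOP-HOMOGENEOUS, `p - E p` on Fourier level exactly `2T` for `p ∈ K_T` (Laplacian eigen-equation
  `Σᵢ (p - p∘flipᵢ) = 4T (p - E p)`): `maxᵢ Infᵢ ≥ C·Var²` with `C` absolute — the route's support item
  `HomogeneousPBAA` (stmt-QuantumAdvantage-15241, open, size L: Escudero Gutiérrez arXiv:2304.06713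
  Thm 1.6 / Cor 1.7 extended from the Fourier-completely-bounded ball `⊇ Q_T` to `K_T`), BY NAME
  (`stub_homogeneousRung`).
The new, load-bearing stub is the REDUCTION `stub_levelDescent` (LEVEL DESCENT WITH POLYNOMIAL LOSS, the
`K_T` form of Escudero Gutiérrez's Question 4.5 / card K2 "cross-level flatness"): every `p ∈ K_T` with
`Var[p] ≥ ε` has a SURROGATE `q ∈ K_{T'}`, `1 ≤ T' ≤ T`, on any number `N'` of variables, lying in one of
the two base classes (`T' = 1` or top-homogeneous of order `T'`), with `Var[q] ≥ A (ε/T)^a` and EVERY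
influence of `q` at most `B` times SOME influence of `p` (the comparison-clause shape of the tree's
`Cruxes/AAConj/SplitAssembly.lean`). The composition `PseudoBoundedAA_of` is real arithmetic:
`Inf_{i'}[p] ≥ Inf_i[q]/B ≥ min(4/9, C)·Var[q]²/B ≥ (min(4/9, C)·A²/B)·(ε/T)^{2a}`, i.e. PB-AA with
`(c, C) := (2a, min(4/9, C)·A²/B)`.

WHY THE REDUCTION IS NOT A COSTUME. `stub_levelDescent` is a CONSEQUENCE of the crux (given PB-AA, the
two-variable level-2 polynomial `1/2 + δ·χ₀χ₁ ∈ K_1`, `4δ² := C(ε/T)^c ≤ Inf_i[p]`, is a surrogate), but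
the converse needs BOTH base theorems, one of which (`HomogeneousPBAA` on `K_T ⊋ Q_T`) is open: if the
homogeneous rung fails on `K_T`, level descent may hold while PB-AA fails. So the crux is cut into
"the structural theorem on the flat classes" and "the transfer to them", neither of which gives the crux
or the summit on its own (BC3 probes `stub → PseudoBoundedAA`, `stub → QuantumAdvantage` by
`first | exact? | simpa | aesop` all FAIL; NOTES.md of the registering seat). The intended DIRECT proofs of
level descent do not pass through PB-AA: (i) noise / random restriction to isolate the top level inside
`K_T` (restrictions preserve `K_T`, support `PseudoBoundedRestrict`), (ii) the cross-level flatness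
equations of a flat band-limited Gram matrix (card K2), (iii) for mass on levels `≤ 2`, an order-1
surrogate from the degree-1 part of the sphere map `F` (`p = ‖ΠF‖²`).

WHY IT MIGHT FAIL (concrete). Level projections of members of `K_T` can have sup-norm and sos-norm
exponential in `T` on the middle levels (Chebyshev / Grover-with-check profiles: level-`k` `ℓ₁`-mass
`≍ T^{Θ(k)}`), so the NAIVE surrogate "rescaled level-`k` projection" loses `exp(T)`, not `poly(T)`
(the route header records that the naive frame-bound route to `T ≥ 2` was refuted before filing,
`κ_top` grows at `T = 3`); level descent then needs cleverer surrogates (noise + restriction + padding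
with fresh variables for level parity), and may be as hard as PB-AA itself (it is implied by it).
A refuter kills it with ONE pseudo-bounded family whose every order-1 / top-homogeneous surrogate with
dominated influences has variance `≤ (ε/T)^{ω(1)}` — by conic duality (support `PseudoBoundedDual`) a
finite SDP per `(N, T)`.

DISPROOF USED: none exists yet (`ledger crux ls stmt-QuantumAdvantage-15237`: no workfiles, no
`Disproof.lean`, no landed `Theorems/PseudoBoundedAA/Negative/*` on 2026-08-17); dead lines: none recorded;
`ledger negatives --problem QuantumAdvantage`: no statement about pseudo-bounded / SOS classes.

BARRIERS. All three stubs are relativization-agnostic pure mathematics on the cube (the route's S-arrow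
barriers `RandomOracleMethod`, `PromiseLiftRelativization`, `Relativization` sit in the OTHER cruxes
TransferPB / X_ROG / PL and are untouched here). `TotalFunctionSpeedupLimit`: consistent — the Boolean
corner `f = f² ∈ K_deg` of every stub is the OSSS/Midrijanis phenomenon. The NORM-SIDE obstruction recorded
in the route header (arXiv:2304.06713 Rem. 4.3: norming functionals cannot see lower Fourier levels;
sup-norm projections pay `exp(d)`) is exactly what `stub_levelDescent` must evade by staying inside the
POSITIVITY class `K` (surrogates are again SOS-sandwiched, never sup-norm truncations).

STUBS (3) and composition:
* `stub_oneQuery` — `OneQueryFrameAA` by name (theorem-type, provable now, M: frames / Bessel);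
* `stub_homogeneousRung` — `HomogeneousPBAA` by name (open, L: E-G Thm 1.6 beyond the fcb ball);
* `stub_levelDescent` — level descent with polynomial loss inside `K` (open, the hardest and load-bearing);
* `PseudoBoundedAA_of` — the crux BY NAME from the two remaining stubs, stub 1 discharged by the imported theorem (real proof: unpack the route decls by
  `Iff.rfl` into the local cube vocabulary, case on the base class of the surrogate, real arithmetic).
`sorry` occurs ONLY in the two remaining `stub_*` theorems (stub 1 is proved in the tree and imported).

Sources: arXiv:2304.06713 (Escudero Gutiérrez: Thm 1.4/1.6, Cor 1.7, Conj 1.5, Question 4.5, Rem 4.3);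
arXiv:0911.0996 (Aaronson–Ambainis, Conj. 6; Thm 9 = DFKO); arXiv:1411.7280 (Kaniewski–Lee–de Wolf Thm 12:
sos degree = query complexity in expectation — the class `K_T`); arXiv:2203.00212 (Bansal–Sinha–de Wolf);
arXiv:1512.01603 (O'Donnell–Zhao Thm 2.13: the comparison-clause reduction shape); doi:10.1017/CBO9781139814782
(O'Donnell, Analysis of Boolean Functions, §2 influences / Poincaré); tree: `Theses/SosSandwich.lean`
(items 15237, 15240, 15241, 15243, 15244), `Cruxes/AAConj/SplitAssembly.lean` (assembly style).
-/

-- `Summit.<Summit>.<Problem>`: for the single-conjunct summit the duplicate `QuantumAdvantage.QuantumAdvantage` is mandated.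
set_option linter.dupNamespace false

noncomputable section

namespace Summit.QuantumAdvantage.QuantumAdvantage.Cruxes.PseudoBoundedAA.Birth

open scoped BigOperators
open Summit.QuantumAdvantage.QuantumAdvantage.Theses.SosSandwich (PseudoBoundedAA HomogeneousPBAA OneQueryFrameAA)

/-! ## Cube vocabulary (DEFINITIONALLY the inline `let ev … let avg …` of the route file) -/

/-- Evaluation of a real polynomial at a Boolean point, `0/1`-coding — the route file's inline `ev`
(definitionally `Literature.Computability.QuantumComplexity.evalBool`). [cite: arXiv:0911.0996, §2] -/
def ev {N : ℕ} (f : MvPolynomial (Fin N) ℝ) (x : Fin N → Bool) : ℝ :=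
  MvPolynomial.eval (fun k => if x k then (1 : ℝ) else 0) f

/-- Uniform average over the cube `{0,1}^N` — the route file's inline `avg` (definitionally `boolAvg`).
[cite: arXiv:0911.0996, §2] -/
def avg {N : ℕ} (g : (Fin N → Bool) → ℝ) : ℝ :=
  (∑ x : Fin N → Bool, g x) / (2 : ℝ) ^ N

/-- Variance of `p` on the cube, `E_x (p(x) - E p)²` (definitionally `boolVariance`).
[cite: arXiv:0911.0996, §2] -/
def cvar {N : ℕ} (p : MvPolynomial (Fin N) ℝ) : ℝ :=
  avg fun x => (ev p x - avg (ev p)) ^ 2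

/-- The (L², un-normalised = 4 × O'Donnell) influence of variable `i` on `p`: `E_x (p(x) - p(x ⊕ eᵢ))²`
(definitionally the tree's `influence`). [cite: arXiv:0911.0996, §2] -/
def infl {N : ℕ} (p : MvPolynomial (Fin N) ℝ) (i : Fin N) : ℝ :=
  avg fun x => (ev p x - ev p (Function.update x i (!x i))) ^ 2

/-- `p` is PSEUDO-BOUNDED OF ORDER `T` (`p ∈ K_T`, the SOS sandwich class): `p` and `1 - p` are both sums
of squares of polynomials of total degree `≤ T` AS FUNCTIONS ON THE CUBE. Verbatim the antecedent of the
route's items (Kaniewski–Lee–de Wolf: sos degree = quantum query complexity in expectation, so `K_T ⊇ Q_T`).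
[cite: arXiv:1411.7280, Thm 12] -/
def PseudoBounded {N : ℕ} (T : ℕ) (p : MvPolynomial (Fin N) ℝ) : Prop :=
  ∃ (m : ℕ) (q r : Fin m → MvPolynomial (Fin N) ℝ),
    (∀ j, (q j).totalDegree ≤ T ∧ (r j).totalDegree ≤ T) ∧
      ∀ x : Fin N → Bool, ev p x = ∑ j, ev (q j) x ^ 2 ∧ 1 - ev p x = ∑ j, ev (r j) x ^ 2

/-- `p - E p` lies on Fourier level exactly `2T` (the TOP level for order `T`): the Laplacian
eigen-equation `Σᵢ (p(x) - p(x ⊕ eᵢ)) = 2·(2T)·(p(x) - E p)` — verbatim the homogeneity antecedent of the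
route's `HomogeneousPBAA`. [cite: arXiv:2304.06713, Thm 1.6] -/
def TopHomogeneous {N : ℕ} (T : ℕ) (p : MvPolynomial (Fin N) ℝ) : Prop :=
  ∀ x : Fin N → Bool,
    ∑ i : Fin N, (ev p x - ev p (Function.update x i (!x i))) = 4 * (T : ℝ) * (ev p x - avg (ev p))

/-! ## The route decls, unpacked into the vocabulary (each `Iff.rfl`: only `let`s are zeta-reduced) -/

/-- The crux `PseudoBoundedAA`, unpacked. [folklore] -/
theorem pseudoBoundedAA_iff :
    PseudoBoundedAA ↔
      ∃ (c : ℕ) (C : ℝ), 0 < C ∧ ∀ (N T : ℕ) (p : MvPolynomial (Fin N) ℝ) (ε : ℝ), 1 ≤ T →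
        PseudoBounded T p → 0 < ε → ε ≤ cvar p → ∃ i : Fin N, C * (ε / T) ^ c ≤ infl p i :=
  Iff.rfl

/-- The support item `OneQueryFrameAA` (T = 1 frame theorem), unpacked. [folklore] -/
theorem oneQueryFrameAA_iff :
    OneQueryFrameAA ↔
      ∀ (N : ℕ) (p : MvPolynomial (Fin N) ℝ), PseudoBounded 1 p → 0 < cvar p →
        ∃ i : Fin N, 4 * cvar p ^ 2 ≤ 9 * infl p i :=
  Iff.rfl

/-- The support item `HomogeneousPBAA` (top-homogeneous rung), unpacked. [folklore] -/
theorem homogeneousPBAA_iff :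
    HomogeneousPBAA ↔
      ∃ C : ℝ, 0 < C ∧ ∀ (N T : ℕ) (p : MvPolynomial (Fin N) ℝ), 1 ≤ T → PseudoBounded T p →
        TopHomogeneous T p → 0 < cvar p → ∃ i : Fin N, C * cvar p ^ 2 ≤ infl p i :=
  Iff.rfl

/-! ## The stubs -/

-- stub 1 `stub_oneQuery : OneQueryFrameAA` — PROVED, imported from
-- `Theorems/SosSandwichPseudoBoundedAAStubOneQuery.lean` (p794765, closed by name on stmt-QuantumAdvantage-15237;
-- re-pointed 2026-08-31 by lead hand leafhand-qadv-sossandwich-1 g0: local sorried copy deleted, zero renaming).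

/-- **stub 2 — the TOP-HOMOGENEOUS base class** (route support item `HomogeneousPBAA`,
stmt-QuantumAdvantage-15241, BY NAME; open, size L): if `p ∈ K_T` and `p - E p` lies on Fourier level
exactly `2T`, then `maxᵢ Infᵢ[p] ≥ C·Var[p]²` with `C` absolute. Known on the Fourier-completely-bounded
ball (Escudero Gutiérrez arXiv:2304.06713 Thm 1.6 / Cor 1.7: outputs of `T`-query algorithms that are
homogeneous of degree `2T` have a variable of influence `≥ Var²`); the stub extends it to the SOS sandwich
class `K_T ⊋ Q_T`. Why it might fail: `K_T ⊄ fcb-ball` (Boolean `f` with `Q_E(f) > deg f`; a flat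
band-limited Gram matrix with `N^T` nearly-dependent frame vectors may spread top-level mass thinly in a
way no unitary chain allows) — then retreat to `K_T ∩` disjoint-orthogonality or to `Q_T` (route kill
criteria: a refutation demotes the line to "T = 1 only"). Sources: arXiv:2304.06713, arXiv:2203.00212. -/
theorem stub_homogeneousRung : HomogeneousPBAA := by
  sorry

/-- **stub 3 — LEVEL DESCENT WITH POLYNOMIAL LOSS inside the positivity class** (NEW, open; the hardest
and load-bearing stub — the route's "LevelDescent", typed): there are `a : ℕ` and `A, B > 0` such that
every `p ∈ K_T` (`T ≥ 1`) with `Var[p] ≥ ε > 0` has a SURROGATE `q` on some number `N'` of variables,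
pseudo-bounded of some order `T'` with `1 ≤ T' ≤ T`, lying in a FLAT BASE CLASS — `T' = 1`, or `q - E q`
top-homogeneous (level exactly `2T'`) — with `Var[q] ≥ A·(ε/T)^a` and EVERY influence of `q` at most `B`
times SOME influence of `p`. (The `K_T` form of Escudero Gutiérrez's Question 4.5 / card K2's cross-level
flatness; comparison-clause shape as in `Cruxes/AAConj/SplitAssembly.lean`.)
Why plausibly true: restrictions and noise preserve `K_T` (support `PseudoBoundedRestrict`) and a
fresh-variable padding `q ↦ y·q + (1-y)·(1-q)` raises the level by one inside `K_{T'+1}`; it is moreover a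
CONSEQUENCE of PB-AA (surrogate `1/2 + δ χ₀χ₁ ∈ K_1`, `4δ² = C(ε/T)^c`). Why it might fail: rescaled
level projections lose `exp(T)` (middle-level `ℓ₁`-mass `T^{Θ(k)}` for Chebyshev/Grover profiles), so a
proof needs genuinely new surrogates and may be as hard as PB-AA; killed by one `K_T` family all of whose
flat surrogates with dominated influences have variance `(ε/T)^{ω(1)}` (an SDP per `(N,T)` via
`PseudoBoundedDual`). Sources: arXiv:2304.06713 (Question 4.5, Rem 4.3), arXiv:1512.01603 (Thm 2.13),
arXiv:0911.0996, arXiv:1411.7280. -/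
theorem stub_levelDescent :
    ∃ (a : ℕ) (A B : ℝ), 0 < A ∧ 0 < B ∧
      ∀ (N T : ℕ) (p : MvPolynomial (Fin N) ℝ) (ε : ℝ), 1 ≤ T → PseudoBounded T p → 0 < ε → ε ≤ cvar p →
        ∃ (N' T' : ℕ) (q : MvPolynomial (Fin N') ℝ), 1 ≤ T' ∧ T' ≤ T ∧ PseudoBounded T' q ∧
          (T' = 1 ∨ TopHomogeneous T' q) ∧ A * (ε / T) ^ a ≤ cvar q ∧
            ∀ i : Fin N', ∃ i' : Fin N, infl q i ≤ B * infl p i' := by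
  sorry

/-! ## Name-keyed aliases of the stub statements — the hypotheses of `PseudoBoundedAA_of`

The native skeleton audit (`#h21_check_skeleton`, run by `ledger skeleton check`) admits a hypothesis of
the composing theorem only if its head constant is a registered obligation or is NAMED like a declared
stub; `__Registered.stub_X` is the statement of `stub_X` under the stub's short name (device of
`Cruxes/BQPNotSmall/Lines/birth.lean`). Each alias is an `abbrev`, definitionally its statement. -/
namespace __Registered

/-- Alias of the statement of `stub_homogeneousRung` (the route item `HomogeneousPBAA`). -/
abbrev stub_homogeneousRung : Prop := HomogeneousPBAA
/-- Alias of the statement of `stub_levelDescent`. -/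
abbrev stub_levelDescent : Prop :=
  ∃ (a : ℕ) (A B : ℝ), 0 < A ∧ 0 < B ∧
    ∀ (N T : ℕ) (p : MvPolynomial (Fin N) ℝ) (ε : ℝ), 1 ≤ T → PseudoBounded T p → 0 < ε → ε ≤ cvar p →
      ∃ (N' T' : ℕ) (q : MvPolynomial (Fin N') ℝ), 1 ≤ T' ∧ T' ≤ T ∧ PseudoBounded T' q ∧
        (T' = 1 ∨ TopHomogeneous T' q) ∧ A * (ε / T) ^ a ≤ cvar q ∧
          ∀ i : Fin N', ∃ i' : Fin N, infl q i ≤ B * infl p i'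

end __Registered

/-! Registered-signature agreement: each stub theorem's signature is, definitionally, the alias it is keyed
by (`Iff.rfl`; only TYPES are compared, no `sorry` enters). -/
example : HomogeneousPBAA ↔ __Registered.stub_homogeneousRung := Iff.rfl
example : (∃ (a : ℕ) (A B : ℝ), 0 < A ∧ 0 < B ∧
    ∀ (N T : ℕ) (p : MvPolynomial (Fin N) ℝ) (ε : ℝ), 1 ≤ T → PseudoBounded T p → 0 < ε → ε ≤ cvar p →
      ∃ (N' T' : ℕ) (q : MvPolynomial (Fin N') ℝ), 1 ≤ T' ∧ T' ≤ T ∧ PseudoBounded T' q ∧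
        (T' = 1 ∨ TopHomogeneous T' q) ∧ A * (ε / T) ^ a ≤ cvar q ∧
          ∀ i : Fin N', ∃ i' : Fin N, infl q i ≤ B * infl p i') ↔ __Registered.stub_levelDescent :=
  Iff.rfl

/-! ## Proved: the composition -/

/-- From a surrogate in a flat base class to an influential variable of the surrogate, with the weaker of
the two base constants: `min (4/9) C · Var[q]² ≤ Inf_i[q]` for some `i`. [folklore] -/
theorem baseClass_influence
    (h1 : ∀ (N : ℕ) (p : MvPolynomial (Fin N) ℝ), PseudoBounded 1 p → 0 < cvar p →
      ∃ i : Fin N, 4 * cvar p ^ 2 ≤ 9 * infl p i)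
    {C : ℝ}
    (hH : ∀ (N T : ℕ) (p : MvPolynomial (Fin N) ℝ), 1 ≤ T → PseudoBounded T p →
      TopHomogeneous T p → 0 < cvar p → ∃ i : Fin N, C * cvar p ^ 2 ≤ infl p i)
    {N' T' : ℕ} {q : MvPolynomial (Fin N') ℝ} (hT' : 1 ≤ T') (hq : PseudoBounded T' q)
    (hbase : T' = 1 ∨ TopHomogeneous T' q) (hv : 0 < cvar q) :
    ∃ i : Fin N', min (4 / 9 : ℝ) C * cvar q ^ 2 ≤ infl q i := by
  have hsq : 0 ≤ cvar q ^ 2 := sq_nonneg _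
  rcases hbase with hT1 | hhom
  · subst hT1
    obtain ⟨i, hi⟩ := h1 N' q hq hv
    refine ⟨i, ?_⟩
    calc min (4 / 9 : ℝ) C * cvar q ^ 2 ≤ 4 / 9 * cvar q ^ 2 :=
          mul_le_mul_of_nonneg_right (min_le_left _ _) hsq
      _ ≤ infl q i := by linarith
  · obtain ⟨i, hi⟩ := hH N' T' q hT' hq hhom hv
    refine ⟨i, ?_⟩
    calc min (4 / 9 : ℝ) C * cvar q ^ 2 ≤ C * cvar q ^ 2 :=
          mul_le_mul_of_nonneg_right (min_le_right _ _) hsq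
      _ ≤ infl q i := hi

/-- **THE SKELETON THEOREM.** The crux
`Summit.QuantumAdvantage.QuantumAdvantage.Theses.SosSandwich.PseudoBoundedAA`, concluded BY NAME from the
two remaining declared stubs and the PROVED stub 1 (`stub_oneQuery`, imported): descend (`q ∈ K_{T'}` in a flat base class, `Var[q] ≥ A(ε/T)^a`, influences of `q`
dominated by `B ×` influences of `p`), take an influential variable of `q` from the base theorems
(`min(4/9, C)·Var[q]² ≤ Inf_i[q]`), and pull it back:
`Inf_{i'}[p] ≥ (min(4/9, C)·A²/B)·(ε/T)^{2a}`. So PB-AA holds with `c := 2a`, `C := min(4/9,C)·A²/B`.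
[folklore] -/
theorem PseudoBoundedAA_of :
    __Registered.stub_homogeneousRung → __Registered.stub_levelDescent →
      Summit.QuantumAdvantage.QuantumAdvantage.Theses.SosSandwich.PseudoBoundedAA := by
  intro hH hD
  dsimp only [__Registered.stub_homogeneousRung, __Registered.stub_levelDescent] at hH hD
  -- stub 1 is PROVED in the tree (`stub_oneQuery`, imported): discharge it here
  have h1 := oneQueryFrameAA_iff.mp stub_oneQuery
  replace hH := homogeneousPBAA_iff.mp hH
  refine pseudoBoundedAA_iff.mpr ?_
  obtain ⟨C, hC, hH⟩ := hH
  obtain ⟨a, A, B, hA, hB, hD⟩ := hD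
  refine ⟨2 * a, min (4 / 9 : ℝ) C * A ^ 2 / B, ?_, ?_⟩
  · exact div_pos (mul_pos (lt_min (by norm_num) hC) (pow_pos hA 2)) hB
  intro N T p ε hT hp hε hεv
  obtain ⟨N', T', q, hT'1, -, hq, hbase, hvar, hdom⟩ := hD N T p ε hT hp hε hεv
  have hT0 : (0 : ℝ) < (T : ℝ) := Nat.cast_pos.mpr (by omega)
  have hfloor : 0 < A * (ε / T) ^ a := mul_pos hA (pow_pos (div_pos hε hT0) a)
  have hvq : 0 < cvar q := lt_of_lt_of_le hfloor hvar
  obtain ⟨i, hi⟩ := baseClass_influence h1 hH hT'1 hq hbase hvq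
  obtain ⟨i', hi'⟩ := hdom i
  refine ⟨i', ?_⟩
  have hm0 : 0 ≤ min (4 / 9 : ℝ) C := le_min (by norm_num) hC.le
  have hsq_le : (A * (ε / T) ^ a) ^ 2 ≤ cvar q ^ 2 := pow_le_pow_left₀ hfloor.le hvar 2
  have step : min (4 / 9 : ℝ) C * A ^ 2 * (ε / T) ^ (2 * a) ≤ B * infl p i' := by
    calc min (4 / 9 : ℝ) C * A ^ 2 * (ε / T) ^ (2 * a)
          = min (4 / 9 : ℝ) C * (A * (ε / T) ^ a) ^ 2 := by rw [pow_mul']; ring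
      _ ≤ min (4 / 9 : ℝ) C * cvar q ^ 2 := mul_le_mul_of_nonneg_left hsq_le hm0
      _ ≤ infl q i := hi
      _ ≤ B * infl p i' := hi'
  have hrew : min (4 / 9 : ℝ) C * A ^ 2 / B * (ε / T) ^ (2 * a) =
      (min (4 / 9 : ℝ) C * A ^ 2 * (ε / T) ^ (2 * a)) / B := by ring
  rw [hrew, div_le_iff₀ hB]
  linarith [step, mul_comm B (infl p i')]

end Summit.QuantumAdvantage.QuantumAdvantage.Cruxes.PseudoBoundedAA.Birth

end
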